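import Summits.HodgeConjecture.HodgeCM.PerL34.BallCR_1

/-! PORT of `HodgeCM/PerL34/BallCR.lean` (HodgeCMPerL run 82) — part 2: continuation of `Summits.HodgeConjecture.HodgeCM.PerL34.BallCR_1` (split at a top-level declaration boundary by port_pkg.py; scope re-opened below; declarations unchanged). -/

-- port_pkg: scope re-opened for this part (file-level context, then the namespace/section stack open at the cut)
set_option autoImplicit false
noncomputable section
open Complex ComplexConjugate
open scoped Matrix
namespace HodgeCM
namespace PerL34
namespace BallCR
open HodgeCM.PerL34.BallModel HodgeCM.PerL34.BallSpans HodgeCM.PerL34.BallFrame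
/-- (Ported verbatim from the HodgeCMPerL package; no docstring in the source.) -/
theorem Jac_sec_cv_eq (v : Fin 2 → ℂ) (i j : Fin 2) (t : ℝ) :
    Jac (sec (cv v t)) x₀ i j = (tOf (cv v t) : ℂ) * (if i = j then 1 else 0) + (t : ℂ) ^ 2 * jacB v i j t := by
  have ht : (tOf (cv v t) : ℂ) ≠ 0 := by exact_mod_cast (tOf_pos _).ne'
  have hp : ((1 + t ^ 2 * nsq v : ℝ) : ℂ) ≠ 0 := by exact_mod_cast (one_add_sq_mul_pos v t).ne'
  have hcOf : (cOf (cv v t) : ℂ) = 1 / (tOf (cv v t) : ℂ) := by simp [cOf]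
  rw [Jac_sec_x₀_apply, jacB, hcOf]
  simp only [cv_val, Pi.smul_apply, smul_eq_mul, map_mul, Complex.conj_ofReal, rOf]
  push_cast at hp ⊢
  field_simp

/-- **No first-order term along boosts**: `t ↦ Jac (g_{c_v(t)}) (x₀)` has derivative `0` at `t = 0`
(the kernel of [BW] II 4.2 (6) for the ball: in the `𝔭₋`-derivative of a `(1,0)`-cochain no zeroth-order /
connection term survives). -/
theorem hasDerivAt_Jac_boost (v : Fin 2 → ℂ) (i j : Fin 2) :
    HasDerivAt (fun t : ℝ => Jac (sec (cv v t)) x₀ i j) 0 0 := by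
  have h1 := (hasDerivAt_tOf_cv v).mul_const (if i = j then (1 : ℂ) else 0)
  have h2 := hasDerivAt_sq_mul (continuous_jacB v i j).continuousAt
  have h := h1.fun_add h2
  have hfun : (fun t : ℝ => Jac (sec (cv v t)) x₀ i j) =
      fun t => (tOf (cv v t) : ℂ) * (if i = j then 1 else 0) + (t : ℂ) ^ 2 * jacB v i j t :=
    funext (Jac_sec_cv_eq v i j)
  rw [hfun]
  exact h.congr_deriv (by simp)

/-! ## 4. The right derivative of a frame function along the boosts -/

/-- `R u (g · g_{c_v(t)}) = ᵗJac(g_{c_v(t)})(x₀) · (g^*u)(c_v(t))`. -/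
theorem R_boost (u : Ball → (Fin 2 → ℂ)) (g : U21) (v : Fin 2 → ℂ) (t : ℝ) :
    R u (g * sec (cv v t)) = (Jac (sec (cv v t)) x₀)ᵀ *ᵥ pullVec g u (cv v t).1 := by
  rw [R_mul, sec_smul_x₀, pullVec_val]

/-- (Ported verbatim from the HodgeCMPerL package; no docstring in the source.) -/
theorem R_boost_apply (u : Ball → (Fin 2 → ℂ)) (g : U21) (v : Fin 2 → ℂ) (t : ℝ) (i : Fin 2) :
    R u (g * sec (cv v t)) i =
      Jac (sec (cv v t)) x₀ 0 i * pullVec g u (cv v t).1 0 + Jac (sec (cv v t)) x₀ 1 i * pullVec g u (cv v t).1 1 := by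
  rw [R_boost]; simp [Matrix.mulVec, dotProduct, Fin.sum_univ_two, Matrix.transpose_apply]

/-- **The boost derivative of a frame function is the derivative of the pullback**: if `g^*u` (in coordinates)
has real derivative `P` at `0`, then `t ↦ R u (g·g_{c_v(t)})` has derivative `P v` at `t = 0`. -/
theorem hasDerivAt_R_boost {u : Ball → (Fin 2 → ℂ)} {g : U21} {P : (Fin 2 → ℂ) →L[ℝ] (Fin 2 → ℂ)}
    (hP : HasFDerivAt (pullVec g u) P 0) (v : Fin 2 → ℂ) :
    HasDerivAt (fun t : ℝ => R u (g * sec (cv v t))) (P v) 0 := by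
  have hc : HasDerivAt (fun t => (cv v t).1) v 0 := hasDerivAt_cv_val v
  have hP' : HasFDerivAt (pullVec g u) P ((fun t => (cv v t).1) 0) := by simpa using hP
  have hcomp : HasDerivAt (pullVec g u ∘ fun t => (cv v t).1) (P v) 0 :=
    HasFDerivAt.comp_hasDerivAt (0 : ℝ) hP' hc
  have hcoord : ∀ j : Fin 2, HasDerivAt (fun t => pullVec g u (cv v t).1 j) (P v j) 0 := fun j =>
    hasDerivAt_pi.1 hcomp j
  rw [hasDerivAt_pi]
  intro i
  have hfun : (fun t : ℝ => R u (g * sec (cv v t)) i) = fun t =>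
      Jac (sec (cv v t)) x₀ 0 i * pullVec g u (cv v t).1 0 + Jac (sec (cv v t)) x₀ 1 i * pullVec g u (cv v t).1 1 :=
    funext fun t => R_boost_apply u g v t i
  rw [hfun]
  have h := ((hasDerivAt_Jac_boost v 0 i).fun_mul (hcoord 0)).fun_add
    ((hasDerivAt_Jac_boost v 1 i).fun_mul (hcoord 1))
  refine h.congr_deriv ?_
  fin_cases i <;> simp [Jac_sec_cv_zero]

/-! ## 5. The derivative of the pullback at the base point -/

/-- (Ported verbatim from the HodgeCMPerL package; no docstring in the source.) -/
theorem pullVec_apply (g : U21) (u : Ball → (Fin 2 → ℂ)) (y : Fin 2 → ℂ) (i : Fin 2) :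
    pullVec g u y i = JacVec g y 0 i * ext u (actVec g y) 0 + JacVec g y 1 i * ext u (actVec g y) 1 := by
  simp [pullVec, Matrix.mulVec, dotProduct, Fin.sum_univ_two, Matrix.transpose_apply]

/-- (Ported verbatim from the HodgeCMPerL package; no docstring in the source.) -/
theorem JacVec_zero (g : U21) : JacVec g 0 = Jac g x₀ := JacVec_val g x₀

/-- (Ported verbatim from the HodgeCMPerL package; no docstring in the source.) -/
theorem isUnit_Jac (g : U21) (z : Ball) : IsUnit (Jac g z) :=
  (Matrix.isUnit_iff_isUnit_det _).2 (isUnit_iff_ne_zero.2 (det_Jac_ne_zero g z))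

/-- The entries of the Jacobian are holomorphic functions of the point (rational, nonvanishing denominator). -/
theorem differentiableAt_JacVec (g : U21) (z : Ball) (i j : Fin 2) :
    DifferentiableAt ℂ (fun y => JacVec g y i j) z.1 := by
  have hD0 : (mat g *ᵥ ![z.1 0, z.1 1, 1]) 2 ≠ 0 := W3_2_ne_zero g z
  have hH : ∀ k, DifferentiableAt ℂ (fun y : Fin 2 → ℂ => (mat g *ᵥ ![y 0, y 1, 1]) k) z.1 :=
    fun k => (hasFDerivAt_homog g k z.1).differentiableAt
  simp only [JacVec, Matrix.of_apply, div_eq_mul_inv]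
  exact (((differentiableAt_const _).fun_mul (hH 2)).fun_sub ((hH _).fun_mul (differentiableAt_const _))).fun_mul
    (((hH 2).fun_pow 2).fun_inv (pow_ne_zero 2 hD0))

/-- The differential of `y ↦ g·y` at the base point, as a real-linear map: `h ↦ Jac g x₀ · h`. -/
def LR (g : U21) : (Fin 2 → ℂ) →L[ℝ] (Fin 2 → ℂ) :=
  (LinearMap.toContinuousLinearMap (Matrix.mulVecLin (Jac g x₀))).restrictScalars ℝ

/-- (Ported verbatim from the HodgeCMPerL package; no docstring in the source.) -/
@[simp] theorem LR_apply (g : U21) (h : Fin 2 → ℂ) : LR g h = Jac g x₀ *ᵥ h := by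
  simp [LR]

/-- (Ported verbatim from the HodgeCMPerL package; no docstring in the source.) -/
theorem hasFDerivAt_actVec_zero (g : U21) : HasFDerivAt (actVec g) (LR g) 0 := by
  simpa [LR] using (hasFDerivAt_actVec g x₀).restrictScalars ℝ

/-- The `ℂ`-derivative of the `(j,i)` entry of `JacVec g` at the base point. -/
def μ (g : U21) (j i : Fin 2) : (Fin 2 → ℂ) →L[ℂ] ℂ := fderiv ℂ (fun y => JacVec g y j i) 0

/-- (Ported verbatim from the HodgeCMPerL package; no docstring in the source.) -/
theorem hasFDerivAt_JacVec_zero (g : U21) (j i : Fin 2) :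
    HasFDerivAt (fun y => JacVec g y j i) ((μ g j i).restrictScalars ℝ) 0 := by
  have h : DifferentiableAt ℂ (fun y => JacVec g y j i) 0 := by simpa using differentiableAt_JacVec g x₀ j i
  exact h.hasFDerivAt.restrictScalars ℝ

/-- The explicit real derivative of the `i`-th coordinate of `g^*u` at `0` (product + chain rule). -/
theorem hasFDerivAt_pullVec_apply {u : Ball → (Fin 2 → ℂ)} {g : U21}
    (hu : DifferentiableAt ℝ (ext u) (actVec g 0)) (i : Fin 2) :
    HasFDerivAt (fun y => pullVec g u y i)
      ((JacVec g 0 0 i • (ContinuousLinearMap.proj 0).comp ((fderiv ℝ (ext u) (actVec g 0)).comp (LR g)) +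
        ext u (actVec g 0) 0 • (μ g 0 i).restrictScalars ℝ) +
       (JacVec g 0 1 i • (ContinuousLinearMap.proj 1).comp ((fderiv ℝ (ext u) (actVec g 0)).comp (LR g)) +
        ext u (actVec g 0) 1 • (μ g 1 i).restrictScalars ℝ)) 0 := by
  have hA := hasFDerivAt_actVec_zero g
  have hE : HasFDerivAt (ext u ∘ actVec g) ((fderiv ℝ (ext u) (actVec g 0)).comp (LR g)) 0 :=
    hu.hasFDerivAt.comp 0 hA
  have hEj : ∀ j : Fin 2, HasFDerivAt (fun y => ext u (actVec g y) j)
      ((ContinuousLinearMap.proj j).comp ((fderiv ℝ (ext u) (actVec g 0)).comp (LR g))) 0 :=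
    fun j => hasFDerivAt_pi'.1 hE j
  have hfun : (fun y => pullVec g u y i) =
      fun y => JacVec g y 0 i * ext u (actVec g y) 0 + JacVec g y 1 i * ext u (actVec g y) 1 :=
    funext fun y => pullVec_apply g u y i
  rw [hfun]
  exact ((hasFDerivAt_JacVec_zero g 0 i).fun_mul (hEj 0)).fun_add ((hasFDerivAt_JacVec_zero g 1 i).fun_mul (hEj 1))

/-- (Ported verbatim from the HodgeCMPerL package; no docstring in the source.) -/
theorem differentiableAt_pullVec {u : Ball → (Fin 2 → ℂ)} {g : U21}
    (hu : DifferentiableAt ℝ (ext u) (actVec g 0)) : DifferentiableAt ℝ (pullVec g u) 0 :=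
  differentiableAt_pi.2 fun i => (hasFDerivAt_pullVec_apply hu i).differentiableAt

/-- Coordinates of the real derivative of `g^*u` at `0`. -/
theorem fderiv_pullVec_apply {u : Ball → (Fin 2 → ℂ)} {g : U21}
    (hu : DifferentiableAt ℝ (ext u) (actVec g 0)) (h : Fin 2 → ℂ) (i : Fin 2) :
    fderiv ℝ (pullVec g u) 0 h i =
      (JacVec g 0 0 i * fderiv ℝ (ext u) (actVec g 0) (Jac g x₀ *ᵥ h) 0 + ext u (actVec g 0) 0 * μ g 0 i h) +
      (JacVec g 0 1 i * fderiv ℝ (ext u) (actVec g 0) (Jac g x₀ *ᵥ h) 1 + ext u (actVec g 0) 1 * μ g 1 i h) := by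
  have h1 := hasFDerivAt_pi'.1 (differentiableAt_pullVec hu).hasFDerivAt i
  have h2 := hasFDerivAt_pullVec_apply hu i
  have h12 := h1.unique h2
  have := congrArg (fun T : (Fin 2 → ℂ) →L[ℝ] ℂ => T h) h12
  simpa [mul_comm] using this

/-- If `u` is HOLOMORPHIC at `g·x₀`, the pullback `g^*u` is `ℂ`-differentiable at `0`. -/
theorem differentiableAt_pullVec_complex {u : Ball → (Fin 2 → ℂ)} {g : U21}
    (hu : DifferentiableAt ℂ (ext u) (actVec g 0)) : DifferentiableAt ℂ (pullVec g u) 0 := by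
  have hA : DifferentiableAt ℂ (actVec g) 0 := by simpa using (hasFDerivAt_actVec g x₀).differentiableAt
  have hE : DifferentiableAt ℂ (ext u ∘ actVec g) 0 := hu.comp 0 hA
  have hEj : ∀ j : Fin 2, DifferentiableAt ℂ (fun y => ext u (actVec g y) j) 0 :=
    fun j => differentiableAt_pi.1 hE j
  have hJ : ∀ j i : Fin 2, DifferentiableAt ℂ (fun y => JacVec g y j i) 0 :=
    fun j i => by simpa using differentiableAt_JacVec g x₀ j i
  refine differentiableAt_pi.2 fun i => ?_
  have hfun : (fun y => pullVec g u y i) =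
      fun y => JacVec g y 0 i * ext u (actVec g y) 0 + JacVec g y 1 i * ext u (actVec g y) 1 :=
    funext fun y => pullVec_apply g u y i
  rw [hfun]
  exact ((hJ 0 i).fun_mul (hEj 0)).fun_add ((hJ 1 i).fun_mul (hEj 1))

/-! ## 6. Cauchy–Riemann transfer and the `ℂ`-linear upgrade -/

/-- **CR transfer.** If the real derivative `P` of `g^*u` at `0` satisfies `P v + i P(iv) = 0` for all `v`
(`∂̄(g^*u)(0) = 0`), then so does the real derivative of `u` at `g·x₀`: the holomorphic factors `ᵗJac g`
(invertible) and `y ↦ g·y` (invertible differential) transfer the Cauchy–Riemann equations. -/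
theorem cr_transfer {u : Ball → (Fin 2 → ℂ)} {g : U21} (hu : DifferentiableAt ℝ (ext u) (actVec g 0))
    (hkill : ∀ v, fderiv ℝ (pullVec g u) 0 v + I • fderiv ℝ (pullVec g u) 0 (I • v) = 0) :
    ∀ k, fderiv ℝ (ext u) (actVec g 0) k + I • fderiv ℝ (ext u) (actVec g 0) (I • k) = 0 := by
  set D := fderiv ℝ (ext u) (actVec g 0) with hD
  have hUnit := isUnit_Jac g x₀
  have hinj : Function.Injective (Jac g x₀)ᵀ.mulVec :=
    Matrix.mulVec_injective_iff_isUnit.2 ((Matrix.isUnit_transpose _).2 hUnit)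
  intro k
  obtain ⟨h, rfl⟩ := (Matrix.mulVec_surjective_iff_isUnit.2 hUnit) k
  have hw : (Jac g x₀)ᵀ *ᵥ (D (Jac g x₀ *ᵥ h) + I • D (I • (Jac g x₀ *ᵥ h))) = (Jac g x₀)ᵀ *ᵥ 0 := by
    rw [Matrix.mulVec_zero]
    funext i
    have hc := congrFun (hkill h) i
    simp only [Pi.add_apply, Pi.smul_apply, smul_eq_mul, Pi.zero_apply] at hc
    rw [fderiv_pullVec_apply hu, fderiv_pullVec_apply hu, Matrix.mulVec_smul, (μ g 0 i).map_smul,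
      (μ g 1 i).map_smul, smul_eq_mul, smul_eq_mul, JacVec_zero] at hc
    simp only [Matrix.mulVec, dotProduct, Fin.sum_univ_two, Matrix.transpose_apply, Pi.add_apply, Pi.smul_apply,
      smul_eq_mul, Pi.zero_apply]
    linear_combination hc - (ext u (actVec g 0) 0 * μ g 0 i h + ext u (actVec g 0) 1 * μ g 1 i h) * Complex.I_mul_I
  exact hinj hw

/-- **`ℂ`-linear upgrade.** A real-differentiable map `ℂ² → ℂ²` whose real derivative at `y` satisfies the
Cauchy–Riemann equations `Df(k) + i·Df(ik) = 0` is `ℂ`-differentiable at `y`. -/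
theorem differentiableAt_complex_of_cr {f : (Fin 2 → ℂ) → (Fin 2 → ℂ)} {y : Fin 2 → ℂ}
    (hf : DifferentiableAt ℝ f y) (hCR : ∀ k, fderiv ℝ f y k + I • fderiv ℝ f y (I • k) = 0) :
    DifferentiableAt ℂ f y := by
  set D := fderiv ℝ f y with hD
  have hI : ∀ k, D (I • k) = I • D k := fun k => by
    have h1 := congrArg (fun w => I • w) (hCR k)
    simp only [smul_add, smul_smul, Complex.I_mul_I, neg_one_smul, smul_zero] at h1
    -- h1 : I • D k + -D (I • k) = 0
    rw [← sub_eq_add_neg, sub_eq_zero] at h1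
    exact h1.symm
  let Dc : (Fin 2 → ℂ) →ₗ[ℂ] (Fin 2 → ℂ) :=
    { toFun := D
      map_add' := fun a b => D.map_add a b
      map_smul' := fun c k => by
        have hk : c • k = (c.re : ℂ) • k + (c.im : ℂ) • (I • k) := by
          rw [smul_smul, ← add_smul, Complex.re_add_im]
        rw [RingHom.id_apply, hk, D.map_add, Complex.coe_smul, Complex.coe_smul, D.map_smul, D.map_smul, hI,
          ← Complex.coe_smul, ← Complex.coe_smul, smul_smul, ← add_smul, Complex.re_add_im] }
  refine (differentiableAt_iff_restrictScalars ℝ hf).2 ⟨LinearMap.toContinuousLinearMap Dc, ?_⟩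
  ext k i
  rfl

/-! ## 7. The canonical ball dictionary and (X2) -/

/-- The `(1,0)`-cochains: frame readings of the real-`C¹` one-forms on the ball. -/
def Cochain : Submodule ℂ (U21 → (Fin 2 → ℂ)) := c1Forms.map R

/-- The holomorphic one-forms, read in the frame. -/
def Hol : Submodule ℂ (U21 → (Fin 2 → ℂ)) := holForms.map R

/-- (Ported verbatim from the HodgeCMPerL package; no docstring in the source.) -/
theorem Hol_le_Cochain : Hol ≤ Cochain :=
  Submodule.map_mono fun u (hu : ballHol u) => ballC1_of_ballHol hu

/-- `∂̄(g^*u)(0)` paired with `v`: the `(0,1)`-part `P v + i P (iv)` of the real derivative `P` of the pullback,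
as a LINEAR map on the `C¹` forms (values: functions of `g`). -/
def dbarPull (v : Fin 2 → ℂ) : c1Forms →ₗ[ℂ] (U21 → (Fin 2 → ℂ)) where
  toFun u := fun g => fderiv ℝ (pullVec g u.1) 0 v + I • fderiv ℝ (pullVec g u.1) 0 (I • v)
  map_add' u u' := by
    funext g
    have hu : DifferentiableAt ℝ (pullVec g u.1) 0 := differentiableAt_pullVec (by rw [actVec_zero_eq]; exact u.2 _)
    have hu' : DifferentiableAt ℝ (pullVec g u'.1) 0 := differentiableAt_pullVec (by rw [actVec_zero_eq]; exact u'.2 _)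
    simp only [Submodule.coe_add, Pi.add_apply]
    rw [show pullVec g (u.1 + u'.1) = pullVec g u.1 + pullVec g u'.1 from pullVec_add g u.1 u'.1, fderiv_add hu hu']
    simp only [FunLike.coe_add, Pi.add_apply, smul_add]
    abel
  map_smul' c u := by
    funext g
    have hu : DifferentiableAt ℝ (pullVec g u.1) 0 := differentiableAt_pullVec (by rw [actVec_zero_eq]; exact u.2 _)
    simp only [Submodule.coe_smul, Pi.smul_apply, RingHom.id_apply]
    rw [show pullVec g (c • u.1) = c • pullVec g u.1 from pullVec_smul g c u.1, fderiv_const_smul hu c]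
    simp only [FunLike.coe_smul, Pi.smul_apply, smul_add, smul_comm c I]

/-- On holomorphic forms `∂̄(g^*u)(0) = 0`: the real derivative of the pullback is `ℂ`-linear. -/
theorem dbar_pullVec_eq_zero_of_hol {u : Ball → (Fin 2 → ℂ)} {g : U21}
    (hu : DifferentiableAt ℂ (ext u) (actVec g 0)) (v : Fin 2 → ℂ) :
    fderiv ℝ (pullVec g u) 0 v + I • fderiv ℝ (pullVec g u) 0 (I • v) = 0 := by
  have hc := differentiableAt_pullVec_complex hu
  rw [(hc.hasFDerivAt.restrictScalars ℝ).fderiv]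
  simp only [ContinuousLinearMap.coe_restrictScalars', map_smul, smul_smul, Complex.I_mul_I, neg_one_smul,
    add_neg_cancel]

/-- A linear complement of `Cochain` inside all functions `U21 → ℂ²`. -/
def cochainCompl : Submodule ℂ (U21 → (Fin 2 → ℂ)) := (Submodule.exists_isCompl Cochain).choose

/-- (Ported verbatim from the HodgeCMPerL package; no docstring in the source.) -/
theorem isCompl_cochainCompl : IsCompl Cochain cochainCompl := (Submodule.exists_isCompl Cochain).choose_spec

/-- The linear projection onto `Cochain` along the chosen complement. -/
def projCochain : (U21 → (Fin 2 → ℂ)) →ₗ[ℂ] Cochain :=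
  Submodule.projectionOnto Cochain cochainCompl isCompl_cochainCompl

/-- (Ported verbatim from the HodgeCMPerL package; no docstring in the source.) -/
theorem projCochain_apply_of_mem {φ : U21 → (Fin 2 → ℂ)} (hφ : φ ∈ Cochain) : projCochain φ = ⟨φ, hφ⟩ :=
  Submodule.projectionOnto_apply_left isCompl_cochainCompl ⟨φ, hφ⟩

/-- `c1Forms ≃ Cochain` along the (injective) frame reading `R`. -/
def cochainEquiv : c1Forms ≃ₗ[ℂ] Cochain := Submodule.equivMapOfInjective R R_injective c1Forms

/-- (Ported verbatim from the HodgeCMPerL package; no docstring in the source.) -/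
theorem cochainEquiv_symm_apply (u : c1Forms) :
    cochainEquiv.symm ⟨R u.1, Submodule.mem_map_of_mem u.2⟩ = u := by
  rw [LinearEquiv.symm_apply_eq]
  apply Subtype.ext
  exact (Submodule.coe_equivMapOfInjective_apply R R_injective c1Forms u).symm

/-- **The operator `X⁻_v ∈ 𝔭₋`** (`v ∈ ℂ²`) as a linear endomorphism of all functions `U21 → ℂ²`: on `Cochain` it is
`φ ↦ (g ↦ ∂̄(g^*u_φ)(0)(v))` = the right derivative `∂_t φ(g g_{c_v(t)})|₀ + i ∂_t φ(g g_{c_{iv}(t)})|₀`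
(`Xminus_apply_of_mem`); off `Cochain` it is extended linearly through `projCochain` (only its kernel on `Cochain`
matters, P43_forms `FormsDictionary`). -/
def Xminus (v : Fin 2 → ℂ) : (U21 → (Fin 2 → ℂ)) →ₗ[ℂ] (U21 → (Fin 2 → ℂ)) :=
  dbarPull v ∘ₗ cochainEquiv.symm.toLinearMap ∘ₗ projCochain

/-- (Ported verbatim from the HodgeCMPerL package; no docstring in the source.) -/
theorem Xminus_R {u : Ball → (Fin 2 → ℂ)} (hu : ballC1 u) (v : Fin 2 → ℂ) :
    Xminus v (R u) = fun g => fderiv ℝ (pullVec g u) 0 v + I • fderiv ℝ (pullVec g u) 0 (I • v) := by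
  have hmem : R u ∈ Cochain := Submodule.mem_map_of_mem (f := R) hu
  have h1 : Xminus v (R u) = dbarPull v (cochainEquiv.symm (projCochain (R u))) := rfl
  rw [h1, projCochain_apply_of_mem hmem, cochainEquiv_symm_apply ⟨u, hu⟩]
  rfl

/-- **The canonical ball dictionary** for pv14's `P43Forms.FormsDictionary U21 ℂ²`. -/
def ballFD : P43Forms.FormsDictionary U21 (Fin 2 → ℂ) where
  Pminus := Set.range Xminus
  Cochain := Cochain
  Hol := Hol

/-- (Ported verbatim from the HodgeCMPerL package; no docstring in the source.) -/
@[simp] theorem ballFD_Pminus : ballFD.Pminus = Set.range Xminus := rfl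
/-- (Ported verbatim from the HodgeCMPerL package; no docstring in the source.) -/
@[simp] theorem ballFD_Cochain : ballFD.Cochain = Cochain := rfl
/-- (Ported verbatim from the HodgeCMPerL package; no docstring in the source.) -/
@[simp] theorem ballFD_Hol : ballFD.Hol = Hol := rfl

/-- **(X2) KERNEL — Cauchy–Riemann in the moving frame** ([BW] II 4.2 (6) + VII 2.5/2.7 for `𝔹² = U(2,1)/K`):
a `(1,0)`-cochain killed by `𝔭₋` is the frame reading of a HOLOMORPHIC one-form. -/
theorem holomorphicOfPminus_ball : P43Forms.HolomorphicOfPminus ballFD := by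
  intro φ hφ hkill
  obtain ⟨u, hu, rfl⟩ := Submodule.mem_map.1 hφ
  refine Submodule.mem_map_of_mem (f := R) (fun z => ?_)
  have hz : actVec (sec z) 0 = z.1 := by rw [actVec_zero_eq, sec_smul_x₀]
  have huz : DifferentiableAt ℝ (ext u) (actVec (sec z) 0) := by rw [hz]; exact hu z
  have hk : ∀ v, fderiv ℝ (pullVec (sec z) u) 0 v + I • fderiv ℝ (pullVec (sec z) u) 0 (I • v) = 0 :=
    fun v => by
      have h := hkill (Xminus v) ⟨v, rfl⟩
      rw [Xminus_R hu] at h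
      exact congrFun h (sec z)
  have hcr := cr_transfer huz hk
  rw [hz] at hcr huz
  exact differentiableAt_complex_of_cr huz hcr

/-- **Converse / non-vacuity**: frame readings of holomorphic forms ARE killed by every `X⁻_v`. -/
theorem Xminus_R_eq_zero_of_hol {u : Ball → (Fin 2 → ℂ)} (hu : ballHol u) (v : Fin 2 → ℂ) :
    Xminus v (R u) = 0 := by
  rw [Xminus_R (ballC1_of_ballHol hu)]
  funext g
  have hug : DifferentiableAt ℂ (ext u) (actVec g 0) := by rw [actVec_zero_eq]; exact hu _
  exact dbar_pullVec_eq_zero_of_hol hug v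

/-- On `(1,0)`-cochains: killed by `𝔭₋` **iff** holomorphic. -/
theorem killed_iff_hol {φ : U21 → (Fin 2 → ℂ)} (hφ : φ ∈ ballFD.Cochain) :
    (∀ X ∈ ballFD.Pminus, X φ = 0) ↔ φ ∈ ballFD.Hol := by
  refine ⟨holomorphicOfPminus_ball φ hφ, fun hhol X hX => ?_⟩
  obtain ⟨v, rfl⟩ := hX
  obtain ⟨u, hu, rfl⟩ := Submodule.mem_map.1 hhol
  exact Xminus_R_eq_zero_of_hol hu v

/-! ## 8. Consequences for the consumers: `HolFrame` / `HolFromBall`, and `X⁻_v` as a curve derivative -/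

/-- (Ported verbatim from the HodgeCMPerL package; no docstring in the source.) -/
theorem continuous_of_ballHol {u : Ball → (Fin 2 → ℂ)} (hu : ballHol u) : Continuous u := by
  have h : u = fun z : Ball => ext u z.1 := funext fun z => (ext_val u z).symm
  rw [h]
  exact continuous_iff_continuousAt.2 fun z => (hu z).continuousAt.comp continuous_subtype_val.continuousAt

/-- Every `φ ∈ ballFD.Hol` is a continuous frame function (pv03 `BallFrame.HolFrame` for any `LineSpans` with this
`Hol`; hence `LineSpans.HolFromBall` by `BallFrame.holFromBall_of_frame`). -/
theorem holFrame_ball {φ : U21 → (Fin 2 → ℂ)} (hφ : φ ∈ ballFD.Hol) : Continuous φ ∧ IsFrameFn φ := by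
  obtain ⟨u, hu, rfl⟩ := Submodule.mem_map.1 hφ
  exact ⟨continuous_R (continuous_of_ballHol hu), isFrameFn_R u⟩

/-- (Ported verbatim from the HodgeCMPerL package; no docstring in the source.) -/
theorem holFrame_of_hol_eq (S : LineSpans) (hS : S.Hol = ballFD.Hol) : HolFrame S :=
  fun _ hφ => holFrame_ball (hS ▸ hφ)

/-- (Ported verbatim from the HodgeCMPerL package; no docstring in the source.) -/
theorem holFromBall_of_hol_eq (S : LineSpans) (hS : S.Hol = ballFD.Hol) : S.HolFromBall :=
  holFromBall_of_frame S (holFrame_of_hol_eq S hS)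

/-- The right derivative of `φ` at `g` along the boost curve through `v`: `∂_t φ(g · g_{c_v(t)})|_{t=0}`. -/
def pDer (φ : U21 → (Fin 2 → ℂ)) (g : U21) (v : Fin 2 → ℂ) : Fin 2 → ℂ :=
  deriv (fun t : ℝ => φ (g * sec (cv v t))) 0

/-- (Ported verbatim from the HodgeCMPerL package; no docstring in the source.) -/
theorem pDer_R {u : Ball → (Fin 2 → ℂ)} (hu : ballC1 u) (g : U21) (v : Fin 2 → ℂ) :
    pDer (R u) g v = fderiv ℝ (pullVec g u) 0 v := by
  have hd : DifferentiableAt ℝ (pullVec g u) 0 := differentiableAt_pullVec (by rw [actVec_zero_eq]; exact hu _)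
  exact (hasDerivAt_R_boost hd.hasFDerivAt v).deriv

/-- **`X⁻_v` IS the `𝔭₋`-derivative** on `(1,0)`-cochains:
`X⁻_v φ (g) = ∂_t φ(g g_{c_v(t)})|₀ + i · ∂_t φ(g g_{c_{iv}(t)})|₀`. -/
theorem Xminus_apply_of_mem {φ : U21 → (Fin 2 → ℂ)} (hφ : φ ∈ ballFD.Cochain) (v : Fin 2 → ℂ) (g : U21) :
    Xminus v φ g = pDer φ g v + I • pDer φ g (I • v) := by
  obtain ⟨u, hu, rfl⟩ := Submodule.mem_map.1 hφ
  rw [Xminus_R hu, pDer_R hu, pDer_R hu]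

end BallCR
end PerL34
end HodgeCM

end

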